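import Summits.HodgeConjecture.HodgeConjecture.Theorems.F0P3cStCharTSTorusLevelBasis   -- ★ p849662 T-BASIS `exists_finset_pairwiseDisjoint_eq_biUnion_smul`
import Summits.HodgeConjecture.HodgeConjecture.Theorems.F0P3cStCharTSHleviCosets       -- ★ p849792 KIT-B (binder shapes `hC` ∕ `hcov` ∕ `hsub`; CM tokens)
import Literature.NumberTheory.Automorphic.CMTorusRegularAEPrelims                    -- ★ `UnitaryGroup.isClosed_torusU_of_t1Space` (`T₂` closed)
import HarnessLib

/-!
# «COSET-COVER★» — the oriented shell pulled back to the `H`-torus is a finite disjoint union of level cosets (ROAD-D, (D-c) ④)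

Count-neutral helper kit for the stable-character transfer statement of the `H413` crux chain
(`--supports stmt-HodgeConjecture-24833`): THEOREMS ONLY, no new objects.  It supplies the coset data `(s, C_j)` of ★ KIT-B
`F0P3cStCharTSHleviCosets.hc_of_cosetSum` — (hC) pairwise disjoint, (hcov)∕(hsub) `t ∈ B₂ ↔ (t_H, u) ∈ C_j` for some `j` along
`t = ι_v γ_H`, `t_H = γ_H.1` — from: the oriented shell `B₂ = b′·S_n ⊆ T₃` (`S_n` a compact subgroup, e.g. `T ∩ 𝓘.K n`), and an OPEN
subgroup `S′ ≤ T_H = T₂ × U(Φ₁)_v` with `ι_v(S′) ⊆ S_n`.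

* §1 **(CC1) generic**: for `Ψ : X → G`, an open subgroup `S′ ≤ X`, and `B ⊆ G` with `Ψ⁻¹(B)` compact and right-`S′`-stable, there is a
  finite set `F` of representatives ON `Ψ⁻¹(B)` with the `u • S′` (`u ∈ F`) pairwise disjoint and `Ψ x ∈ B ↔ ∃ u ∈ F, x ∈ u • S′`
  (`exists_finset_pairwiseDisjoint_preimage_iff`, ★ T-BASIS).
* §2 **(CC2)** `ι_v ∘ (T₂ ↪ U(Φ₂)_v) × id` is a closed embedding, so the pull-back of a compact `B₂ ⊆ T₃` is compact
  (`isClosedEmbedding_psi0`, `isCompact_preimage_psi0`).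
* §3 **(CC3) core** `exists_cosetCover`: the finite disjoint family `u • S′` (representatives ON the shell) with the COUNT form
  `Ψ₀⁻¹(b′·S_n) = ⋃_{u ∈ F} u • S′` on `T_H` and the graph form `t ∈ b′·S_n ↔ ∃ u ∈ F, (t_H, u₁) ∈ u • S′` whenever `t = ι_v(t_H, u₁)`
  (no transport map into `T₃` is built).
* §4 **(CC4)** the `hcov` ∕ `hsub` clauses of ★ `hc_of_cosetSum` in their verbatim binder shape (`hcov_of_cosetCover`, `hsub_of_cosetCover`),
  from the core equivalence taken as a hypothesis.

## References
* [Rogawski1990] J. D. Rogawski, *Automorphic Representations of Unitary Groups in Three Variables* (1990), §4.9 Lemma 4.9.2 p. 56;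
  §12.7 L. 12.7.3 (proof) p. 195 (the `H`-side test function as a sum over level cosets of the torus).
* [Casselman1995] W. Casselman, *Introduction to the theory of admissible representations of p-adic reductive groups* (1995), §1.4
  Prop. 1.4.4 p. 14 (compact open level groups; compact sets are finite unions of cosets).
* [BourbakiGT1] N. Bourbaki, *General Topology* I, Ch. I §10 (proper maps ∕ closed embeddings: preimages of compact sets).
-/

set_option autoImplicit false
-- the mandated namespace has the single-problem summit's repeated segment (`HodgeConjecture.HodgeConjecture`)
set_option linter.dupNamespace false

noncomputable section

open Set Topology Matrix NumberField IsDedekindDomain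
open scoped Pointwise MatrixGroups
open Literature.NumberTheory.Rogawski1990 Literature.NumberTheory.Automorphic Literature.NumberTheory.Automorphic.UnitaryGroup
open Literature.NumberTheory.GaloisRepresentations
open Summit.HodgeConjecture.HodgeConjecture.Cruxes.H413.F0P3cStCharTSTorusLevelBasis

namespace Summit.HodgeConjecture.HodgeConjecture.Cruxes.H413.F0P3cStCharTSCosetCover

/-! ## §1 (CC1) Generic: the preimage of a coset-stable set under any map is a finite disjoint union of level cosets -/

section Generic

variable {X G : Type*} [Group X] [TopologicalSpace X] [IsTopologicalGroup X]

/-- **(CC1) COSET COVER, generic form.**  `Ψ : X → G` any map, `S′ ≤ X` an OPEN subgroup, `B ⊆ G` with `Ψ⁻¹(B)` COMPACT and stable under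
right multiplication by `S′`.  Then there is a finite set `F ⊆ Ψ⁻¹(B)` of representatives with the cosets `u • S′` (`u ∈ F`) pairwise disjoint
and `Ψ x ∈ B ↔ ∃ u ∈ F, x ∈ u • S′` (★ T-BASIS on `S := Ψ⁻¹(B)`). [cite: Casselman1995, §1.4 Prop. 1.4.4 p. 14]
[cite: Rogawski1990, §12.7 L. 12.7.3 (proof) p. 195] -/
theorem exists_finset_pairwiseDisjoint_preimage_iff (Ψ : X → G) (S' : Subgroup X) (hS' : IsOpen (S' : Set X)) {B : Set G}
    (hA : IsCompact (Ψ ⁻¹' B)) (hstab : ∀ x, Ψ x ∈ B → ∀ k ∈ S', Ψ (x * k) ∈ B) :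
    ∃ F : Finset X, (∀ u ∈ F, Ψ u ∈ B) ∧ (↑F : Set X).PairwiseDisjoint (fun u => u • (S' : Set X)) ∧
      ∀ x, Ψ x ∈ B ↔ ∃ u ∈ F, x ∈ u • (S' : Set X) := by
  obtain ⟨F, hFS, hFd, hSF⟩ := exists_finset_pairwiseDisjoint_eq_biUnion_smul S' hS' hA (fun s hs k hk => hstab s hs k hk)
  refine ⟨F, fun u hu => ?_, hFd, fun x => ?_⟩
  · exact hFS u hu (Set.mem_smul_set.2 ⟨1, S'.one_mem, by rw [smul_eq_mul, mul_one]⟩)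
  · change x ∈ Ψ ⁻¹' B ↔ _
    rw [hSF, Set.mem_iUnion₂]
    simp only [exists_prop]

omit [TopologicalSpace X] [IsTopologicalGroup X] in
/-- **(CC1′) stability from a subgroup-valued level**: if `Ψ` is multiplicative into a group, `B = b′ • S` for a subgroup `S`, and `Ψ(S′) ⊆ S`,
then `Ψ⁻¹(B)` is right-`S′`-stable. [cite: Rogawski1990, §12.7 L. 12.7.3 (proof) p. 195] -/
theorem preimage_smul_stable {H : Type*} [Group H] (Ψ : X →* H) (S' : Subgroup X) (S : Subgroup H) (hΨ : ∀ k ∈ S', Ψ k ∈ S)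
    (b' : H) (x : X) (hx : Ψ x ∈ b' • (S : Set H)) (k : X) (hk : k ∈ S') : Ψ (x * k) ∈ b' • (S : Set H) := by
  rw [mem_leftCoset_iff] at hx ⊢
  rw [map_mul, ← mul_assoc]
  exact S.mul_mem hx (hΨ k hk)

end Generic

/-! ## §2 (CC2) The pull-back map `Ψ₀ = ι_v ∘ ((T₂ ↪ U(Φ₂)_v) × id)` is a closed embedding -/

section CM

variable (L : Type) [Field L] [NumberField L] [IsCMField L] (v : HeightOneSpectrum (𝓞 ↥(maximalRealSubfield L)))
  (w : PlacesOver L v) (hw : IsCMField.complexConj L • w.1 = w.1)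

/-- **(CC2)** `x ↦ ι_v(↑x.1, x.2)` on `T₂ × U(Φ₁)_v` is a closed embedding (★ `isClosedEmbedding_endoEmbLocal` composed with the closed embedding
`Subtype.val × id`, `T₂` being closed by ★ `UnitaryGroup.isClosed_torusU_of_t1Space`). [cite: BourbakiGT1, Ch. I §10] -/
theorem isClosedEmbedding_psi0 :
    IsClosedEmbedding (fun x : ↥(cmBorelTriple L 2 v).M ×
        (cmDatum L 1 (Matrix.of fun i j : Fin 1 => if i.val + j.val + 1 = 1 then (1 : L) else 0)).Local v =>
      endoEmbLocal L v ((x.1 : ↥(unitaryGroupOfForm (conjLocal L (IsCMField.complexConj L) v) (cmLocalForm L 2 v))), x.2)) := by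
  have hT2cl : IsClosed ((cmBorelTriple L 2 v).M : Set ↥(unitaryGroupOfForm (conjLocal L (IsCMField.complexConj L) v) (cmLocalForm L 2 v))) :=
    isClosed_torusU_of_t1Space (conjLocal L (IsCMField.complexConj L) v) (cmLocalForm L 2 v)
  exact (isClosedEmbedding_endoEmbLocal L v).comp (hT2cl.isClosedEmbedding_subtypeVal.prodMap IsClosedEmbedding.id)

/-- **(CC2′)** the pull-back of a compact `B₂ ⊆ T₃` along `Ψ₀` is compact. [cite: BourbakiGT1, Ch. I §10] -/
theorem isCompact_preimage_psi0 {B₂ : Set ↥(cmBorelTriple L 3 v).M} (hB₂ : IsCompact B₂) :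
    IsCompact ((fun x : ↥(cmBorelTriple L 2 v).M ×
        (cmDatum L 1 (Matrix.of fun i j : Fin 1 => if i.val + j.val + 1 = 1 then (1 : L) else 0)).Local v =>
      endoEmbLocal L v ((x.1 : ↥(unitaryGroupOfForm (conjLocal L (IsCMField.complexConj L) v) (cmLocalForm L 2 v))), x.2)) ⁻¹'
      (Subtype.val '' B₂)) :=
  (isClosedEmbedding_psi0 L v).isCompact_preimage (hB₂.image continuous_subtype_val)

/-! ## §3 (CC3) The core: `b′·S_n` pulled back to `T_H` is `⨆_{u ∈ F} u·S′` -/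

set_option maxHeartbeats 400000 in  -- statement-level `whnf` on the CM carriers (as ★ `F0P3cStCharTSOnStratumLeviFrame`)
/-- **(CC3) COSET COVER of the oriented shell.**  `S_n ≤ T₃` a COMPACT subgroup (e.g. `T ∩ 𝓘.K n`, ★ T-BASIS `isCompact_inter_K`), `b′ ∈ T₃`
(`B₂ := b′·S_n`, the oriented shell of ★ `F0P3cStCharTSShellOrientation`), `S′ ≤ T_H = T₂ × U(Φ₁)_v` an OPEN subgroup with `ι_v(S′) ⊆ S_n`.  Then there is a
finite set `F ⊆ T_H` of representatives ON the shell with the cosets `u • S′` (`u ∈ F`) pairwise disjoint, the COUNT form `Ψ₀⁻¹(b′·S_n) = ⋃_{u ∈ F} u • S′`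
(`Ψ₀ x := ι_v(↑x.1, x.2)`; for ★ `card_mul_measure_eq_of_cover`), and for every `x ∈ T_H` and `t ∈ T₃` with `t = ι_v(↑x.1, x.2)`: `t ∈ b′·S_n ↔ ∃ u ∈ F, x ∈ u • S′`. [cite: Rogawski1990, §4.9 Lemma 4.9.2 p. 56; §12.7 L. 12.7.3 (proof) p. 195]
[cite: Casselman1995, §1.4 Prop. 1.4.4 p. 14] -/
theorem exists_cosetCover (Sn : Subgroup ↥(cmBorelTriple L 3 v).M) (hSn : IsCompact (Sn : Set ↥(cmBorelTriple L 3 v).M))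
    (b' : ↥(cmBorelTriple L 3 v).M)
    (S' : Subgroup (↥(cmBorelTriple L 2 v).M ×
      (cmDatum L 1 (Matrix.of fun i j : Fin 1 => if i.val + j.val + 1 = 1 then (1 : L) else 0)).Local v))
    (hS' : IsOpen (S' : Set (↥(cmBorelTriple L 2 v).M ×
      (cmDatum L 1 (Matrix.of fun i j : Fin 1 => if i.val + j.val + 1 = 1 then (1 : L) else 0)).Local v)))
    (hΨ : ∀ k ∈ S', ∃ s ∈ Sn,
      endoEmbLocal L v ((k.1 : ↥(unitaryGroupOfForm (conjLocal L (IsCMField.complexConj L) v) (cmLocalForm L 2 v))), k.2) =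
        ((s : ↥(cmBorelTriple L 3 v).M) : ↥(unitaryGroupOfForm (conjLocal L (IsCMField.complexConj L) v) (cmLocalForm L 3 v)))) :
    ∃ F : Finset (↥(cmBorelTriple L 2 v).M ×
        (cmDatum L 1 (Matrix.of fun i j : Fin 1 => if i.val + j.val + 1 = 1 then (1 : L) else 0)).Local v),
      (∀ u ∈ F, ∃ t ∈ b' • (Sn : Set ↥(cmBorelTriple L 3 v).M),
        (t : ↥(unitaryGroupOfForm (conjLocal L (IsCMField.complexConj L) v) (cmLocalForm L 3 v))) =
          endoEmbLocal L v ((u.1 : ↥(unitaryGroupOfForm (conjLocal L (IsCMField.complexConj L) v) (cmLocalForm L 2 v))), u.2)) ∧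
      (↑F : Set (↥(cmBorelTriple L 2 v).M ×
        (cmDatum L 1 (Matrix.of fun i j : Fin 1 => if i.val + j.val + 1 = 1 then (1 : L) else 0)).Local v)).PairwiseDisjoint
          (fun u => u • (S' : Set (↥(cmBorelTriple L 2 v).M ×
            (cmDatum L 1 (Matrix.of fun i j : Fin 1 => if i.val + j.val + 1 = 1 then (1 : L) else 0)).Local v))) ∧
      (fun x : ↥(cmBorelTriple L 2 v).M ×
          (cmDatum L 1 (Matrix.of fun i j : Fin 1 => if i.val + j.val + 1 = 1 then (1 : L) else 0)).Local v =>
        endoEmbLocal L v ((x.1 : ↥(unitaryGroupOfForm (conjLocal L (IsCMField.complexConj L) v) (cmLocalForm L 2 v))), x.2)) ⁻¹'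
          (Subtype.val '' (b' • (Sn : Set ↥(cmBorelTriple L 3 v).M))) =
        ⋃ u ∈ F, u • (S' : Set (↥(cmBorelTriple L 2 v).M ×
            (cmDatum L 1 (Matrix.of fun i j : Fin 1 => if i.val + j.val + 1 = 1 then (1 : L) else 0)).Local v)) ∧
      ∀ (x : ↥(cmBorelTriple L 2 v).M ×
          (cmDatum L 1 (Matrix.of fun i j : Fin 1 => if i.val + j.val + 1 = 1 then (1 : L) else 0)).Local v)
        (t : ↥(cmBorelTriple L 3 v).M),
        (t : ↥(unitaryGroupOfForm (conjLocal L (IsCMField.complexConj L) v) (cmLocalForm L 3 v))) =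
          endoEmbLocal L v ((x.1 : ↥(unitaryGroupOfForm (conjLocal L (IsCMField.complexConj L) v) (cmLocalForm L 2 v))), x.2) →
        (t ∈ b' • (Sn : Set ↥(cmBorelTriple L 3 v).M) ↔
          ∃ u ∈ F, x ∈ u • (S' : Set (↥(cmBorelTriple L 2 v).M ×
            (cmDatum L 1 (Matrix.of fun i j : Fin 1 => if i.val + j.val + 1 = 1 then (1 : L) else 0)).Local v))) := by
  have hB₂c : IsCompact (b' • (Sn : Set ↥(cmBorelTriple L 3 v).M)) := hSn.smul b'
  have hA := isCompact_preimage_psi0 L v hB₂c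
  -- multiplicativity of the pull-back map `x ↦ ι_v(↑x.1, x.2)`
  have hmul : ∀ x k : ↥(cmBorelTriple L 2 v).M ×
      (cmDatum L 1 (Matrix.of fun i j : Fin 1 => if i.val + j.val + 1 = 1 then (1 : L) else 0)).Local v,
      endoEmbLocal L v (((x * k).1 : ↥(unitaryGroupOfForm (conjLocal L (IsCMField.complexConj L) v) (cmLocalForm L 2 v))), (x * k).2) =
        endoEmbLocal L v ((x.1 : ↥(unitaryGroupOfForm (conjLocal L (IsCMField.complexConj L) v) (cmLocalForm L 2 v))), x.2) *
          endoEmbLocal L v ((k.1 : ↥(unitaryGroupOfForm (conjLocal L (IsCMField.complexConj L) v) (cmLocalForm L 2 v))), k.2) :=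
    fun x k => by rw [← map_mul, Prod.mk_mul_mk]; rfl
  -- right-`S′`-stability of the pull-back
  have hstab : ∀ x : ↥(cmBorelTriple L 2 v).M ×
      (cmDatum L 1 (Matrix.of fun i j : Fin 1 => if i.val + j.val + 1 = 1 then (1 : L) else 0)).Local v,
      (fun x : ↥(cmBorelTriple L 2 v).M ×
          (cmDatum L 1 (Matrix.of fun i j : Fin 1 => if i.val + j.val + 1 = 1 then (1 : L) else 0)).Local v =>
        endoEmbLocal L v ((x.1 : ↥(unitaryGroupOfForm (conjLocal L (IsCMField.complexConj L) v) (cmLocalForm L 2 v))), x.2)) x ∈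
          Subtype.val '' (b' • (Sn : Set ↥(cmBorelTriple L 3 v).M)) →
      ∀ k ∈ S', (fun x : ↥(cmBorelTriple L 2 v).M ×
          (cmDatum L 1 (Matrix.of fun i j : Fin 1 => if i.val + j.val + 1 = 1 then (1 : L) else 0)).Local v =>
        endoEmbLocal L v ((x.1 : ↥(unitaryGroupOfForm (conjLocal L (IsCMField.complexConj L) v) (cmLocalForm L 2 v))), x.2)) (x * k) ∈
          Subtype.val '' (b' • (Sn : Set ↥(cmBorelTriple L 3 v).M)) := by
    rintro x ⟨t, ht, htx⟩ k hk
    obtain ⟨s, hs, hks⟩ := hΨ k hk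
    refine ⟨t * s, ?_, ?_⟩
    · rw [mem_leftCoset_iff] at ht ⊢
      rw [← mul_assoc]
      exact Sn.mul_mem ht hs
    · show ((t * s : ↥(cmBorelTriple L 3 v).M) : ↥(unitaryGroupOfForm (conjLocal L (IsCMField.complexConj L) v) (cmLocalForm L 3 v))) =
        endoEmbLocal L v (((x * k).1 : ↥(unitaryGroupOfForm (conjLocal L (IsCMField.complexConj L) v) (cmLocalForm L 2 v))), (x * k).2)
      rw [hmul, Subgroup.coe_mul, hks]
      exact congrArg (fun y => y * ((s : ↥(cmBorelTriple L 3 v).M) : ↥(unitaryGroupOfForm (conjLocal L (IsCMField.complexConj L) v) (cmLocalForm L 3 v)))) htx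
  obtain ⟨F, hFB, hFd, hiff⟩ := exists_finset_pairwiseDisjoint_preimage_iff
    (fun x : ↥(cmBorelTriple L 2 v).M ×
        (cmDatum L 1 (Matrix.of fun i j : Fin 1 => if i.val + j.val + 1 = 1 then (1 : L) else 0)).Local v =>
      endoEmbLocal L v ((x.1 : ↥(unitaryGroupOfForm (conjLocal L (IsCMField.complexConj L) v) (cmLocalForm L 2 v))), x.2))
    S' hS' hA hstab
  refine ⟨F, fun u hu => ?_, hFd, ?_, fun x t hxt => ?_⟩
  · obtain ⟨t, ht, htu⟩ := hFB u hu
    exact ⟨t, ht, htu⟩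
  · refine Set.ext fun x => (hiff x).trans ?_
    simp only [Set.mem_iUnion, exists_prop]
  · rw [← hiff x]
    constructor
    · exact fun ht => ⟨t, ht, hxt⟩
    · rintro ⟨t', ht', ht'x⟩
      rwa [Subtype.val_injective (ht'x.trans hxt.symm)] at ht'

/-! ## §4 (CC4) The `hcov` ∕ `hsub` clauses of ★ KIT-B in their verbatim binder shape -/

/-- **(CC4) `hcov`** of ★ `F0P3cStCharTSHleviCosets.hc_of_cosetSum` with `C := fun u => u • S′`, `s := F`, from the core equivalence `hF` of
`exists_cosetCover` (conjunct 3) — all `hlevi` binders carried verbatim (`(↑t_H, γ_H.2) = γ_H` by `htH`).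
[cite: Rogawski1990, §4.9 Lemma 4.9.2 p. 56; §12.7 L. 12.7.3 (proof) p. 195] -/
theorem hcov_of_cosetCover (B₂ : Set ↥(cmBorelTriple L 3 v).M)
    (S' : Subgroup (↥(cmBorelTriple L 2 v).M ×
      (cmDatum L 1 (Matrix.of fun i j : Fin 1 => if i.val + j.val + 1 = 1 then (1 : L) else 0)).Local v))
    (F : Finset (↥(cmBorelTriple L 2 v).M ×
      (cmDatum L 1 (Matrix.of fun i j : Fin 1 => if i.val + j.val + 1 = 1 then (1 : L) else 0)).Local v))
    (hF : ∀ (x : ↥(cmBorelTriple L 2 v).M ×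
          (cmDatum L 1 (Matrix.of fun i j : Fin 1 => if i.val + j.val + 1 = 1 then (1 : L) else 0)).Local v)
        (t : ↥(cmBorelTriple L 3 v).M),
        (t : ↥(unitaryGroupOfForm (conjLocal L (IsCMField.complexConj L) v) (cmLocalForm L 3 v))) =
          endoEmbLocal L v ((x.1 : ↥(unitaryGroupOfForm (conjLocal L (IsCMField.complexConj L) v) (cmLocalForm L 2 v))), x.2) →
        (t ∈ B₂ ↔ ∃ u ∈ F, x ∈ u • (S' : Set (↥(cmBorelTriple L 2 v).M ×
            (cmDatum L 1 (Matrix.of fun i j : Fin 1 => if i.val + j.val + 1 = 1 then (1 : L) else 0)).Local v)))) :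
    ∀ (γH : ((cmDatum L 2 (Matrix.of fun i j : Fin 2 => if i.val + j.val + 1 = 2 then (1 : L) else 0)).Local v ×
        (cmDatum L 1 (Matrix.of fun i j : Fin 1 => if i.val + j.val + 1 = 1 then (1 : L) else 0)).Local v))
      (d' : Fin 2 → (LocalRing L v)ˣ), glDiagonal 2 (LocalRing L v) d' = ((γH.1).val : GL (Fin 2) (LocalRing L v)) → IsLocalGRegular L v γH →
      Valued.v (((d' 1 : (LocalRing L v)ˣ) : LocalRing L v) w) < Valued.v (((d' 0 : (LocalRing L v)ˣ) : LocalRing L v) w) →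
      galAdicCompletionMap (L := L) (IsCMField.complexConj L) hw (((d' 0 : (LocalRing L v)ˣ) : LocalRing L v) w) *
        ((d' 1 : (LocalRing L v)ˣ) : LocalRing L v) w = 1 →
      ∀ (tH : ↥(cmBorelTriple L 2 v).M),
        (tH : ↥(unitaryGroupOfForm (conjLocal L (IsCMField.complexConj L) v) (cmLocalForm L 2 v))) = γH.1 →
      ∀ (t : ↥(cmBorelTriple L 3 v).M),
        (t : ↥(unitaryGroupOfForm (conjLocal L (IsCMField.complexConj L) v) (cmLocalForm L 3 v))) = endoEmbLocal L v γH →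
      t ∈ B₂ → ∃ j ∈ F, (tH, γH.2) ∈ j • (S' : Set (↥(cmBorelTriple L 2 v).M ×
        (cmDatum L 1 (Matrix.of fun i j : Fin 1 => if i.val + j.val + 1 = 1 then (1 : L) else 0)).Local v)) := by
  intro γH _ _ _ _ _ tH htH t ht htB
  refine (hF (tH, γH.2) t ?_).1 htB
  show (t : ↥(unitaryGroupOfForm (conjLocal L (IsCMField.complexConj L) v) (cmLocalForm L 3 v))) =
    endoEmbLocal L v ((tH : ↥(unitaryGroupOfForm (conjLocal L (IsCMField.complexConj L) v) (cmLocalForm L 2 v))), γH.2)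
  rw [htH, Prod.mk.eta]
  exact ht

/-- **(CC4) `hsub`** of ★ `F0P3cStCharTSHleviCosets.hc_of_cosetSum` with `C := fun u => u • S′`, `s := F`, from the core equivalence `hF`.
[cite: Rogawski1990, §4.9 Lemma 4.9.2 p. 56; §12.7 L. 12.7.3 (proof) p. 195] -/
theorem hsub_of_cosetCover (B₂ : Set ↥(cmBorelTriple L 3 v).M)
    (S' : Subgroup (↥(cmBorelTriple L 2 v).M ×
      (cmDatum L 1 (Matrix.of fun i j : Fin 1 => if i.val + j.val + 1 = 1 then (1 : L) else 0)).Local v))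
    (F : Finset (↥(cmBorelTriple L 2 v).M ×
      (cmDatum L 1 (Matrix.of fun i j : Fin 1 => if i.val + j.val + 1 = 1 then (1 : L) else 0)).Local v))
    (hF : ∀ (x : ↥(cmBorelTriple L 2 v).M ×
          (cmDatum L 1 (Matrix.of fun i j : Fin 1 => if i.val + j.val + 1 = 1 then (1 : L) else 0)).Local v)
        (t : ↥(cmBorelTriple L 3 v).M),
        (t : ↥(unitaryGroupOfForm (conjLocal L (IsCMField.complexConj L) v) (cmLocalForm L 3 v))) =
          endoEmbLocal L v ((x.1 : ↥(unitaryGroupOfForm (conjLocal L (IsCMField.complexConj L) v) (cmLocalForm L 2 v))), x.2) →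
        (t ∈ B₂ ↔ ∃ u ∈ F, x ∈ u • (S' : Set (↥(cmBorelTriple L 2 v).M ×
            (cmDatum L 1 (Matrix.of fun i j : Fin 1 => if i.val + j.val + 1 = 1 then (1 : L) else 0)).Local v)))) :
    ∀ (γH : ((cmDatum L 2 (Matrix.of fun i j : Fin 2 => if i.val + j.val + 1 = 2 then (1 : L) else 0)).Local v ×
        (cmDatum L 1 (Matrix.of fun i j : Fin 1 => if i.val + j.val + 1 = 1 then (1 : L) else 0)).Local v))
      (d' : Fin 2 → (LocalRing L v)ˣ), glDiagonal 2 (LocalRing L v) d' = ((γH.1).val : GL (Fin 2) (LocalRing L v)) → IsLocalGRegular L v γH →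
      Valued.v (((d' 1 : (LocalRing L v)ˣ) : LocalRing L v) w) < Valued.v (((d' 0 : (LocalRing L v)ˣ) : LocalRing L v) w) →
      galAdicCompletionMap (L := L) (IsCMField.complexConj L) hw (((d' 0 : (LocalRing L v)ˣ) : LocalRing L v) w) *
        ((d' 1 : (LocalRing L v)ˣ) : LocalRing L v) w = 1 →
      ∀ (tH : ↥(cmBorelTriple L 2 v).M),
        (tH : ↥(unitaryGroupOfForm (conjLocal L (IsCMField.complexConj L) v) (cmLocalForm L 2 v))) = γH.1 →
      ∀ (t : ↥(cmBorelTriple L 3 v).M),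
        (t : ↥(unitaryGroupOfForm (conjLocal L (IsCMField.complexConj L) v) (cmLocalForm L 3 v))) = endoEmbLocal L v γH →
      ∀ j ∈ F, (tH, γH.2) ∈ j • (S' : Set (↥(cmBorelTriple L 2 v).M ×
        (cmDatum L 1 (Matrix.of fun i j : Fin 1 => if i.val + j.val + 1 = 1 then (1 : L) else 0)).Local v)) → t ∈ B₂ := by
  intro γH _ _ _ _ _ tH htH t ht j hj hmem
  refine (hF (tH, γH.2) t ?_).2 ⟨j, hj, hmem⟩
  show (t : ↥(unitaryGroupOfForm (conjLocal L (IsCMField.complexConj L) v) (cmLocalForm L 3 v))) =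
    endoEmbLocal L v ((tH : ↥(unitaryGroupOfForm (conjLocal L (IsCMField.complexConj L) v) (cmLocalForm L 2 v))), γH.2)
  rw [htH, Prod.mk.eta]
  exact ht

end CM

end Summit.HodgeConjecture.HodgeConjecture.Cruxes.H413.F0P3cStCharTSCosetCover

end
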